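import Literature.MathematicalPhysics.QuantumLattice.WilsonDiracAP
import Literature.MathematicalPhysics.QuantumLattice.OverlapLocality
import Literature.Barriers.QuantumFields.WilsonDeterminantSign

/-!
# The uniform scalar twist of a `U(3)` lattice gauge field (support for stub `stub_indexAPSubPerLeWindow`)
(line `block-away-the-sign`, crux `Summit.QuantumFields.QCD.Theses.SpectralDefectExtinction.ExtinctionBuildsQCD`,
item stmt-QuantumFields-18064)

For a central element `u = c • 1 ∈ U(3)` (`|c| = 1`) and a `U(3)` gauge field `V` on the four-torus, the
uniformly twisted field `e ↦ u · V e`, in the defining representation: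

* `wilsonHop_twist` — the tree's hopping matrix (`OverlapLocality.wilsonHop`, forward hop `⊗ ½(1−γ_μ)` plus
  backward hop `⊗ ½(1+γ_μ)`) of the twisted field is `W_μ(c·V) = Re c · W_μ(V) + Im c · W_μ(i·V)`;
* `norm_wilsonDirac_twist_sub_le`, `norm_hermitianWilsonDirac_twist_sub_le` — since each `W_μ` is an
  isometry (`l2_opNorm_wilsonHop_le`) and `D_W(·, m, 1) = (m+4)·1 − Σ_μ W_μ` (`wilsonDirac_eq_sub_sum_wilsonHop`),
  `‖D_W(c·V) − D_W(V)‖ ≤ 8|c − 1|` and `‖Γ₅ D_W(c·V) − Γ₅ D_W(V)‖ ≤ 8|c − 1|` in the `ℓ²` operator norm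
  (`‖Γ₅‖ ≤ 1`, a Hermitian involution).

No new definitions: the twist is the literal `fun e => u * V e` and `u` is any element of `U(3)` whose matrix
is `c • 1` (`smul_one_mem_unitaryGroup` provides them).

Reference: I. Montvay, G. Münster, *Quantum Fields on a Lattice* (1994), §4.2.4 (4.112)–(4.115)
(boundary phases as a uniform twist of the hopping terms).
-/

noncomputable section

namespace Summit.QuantumFields.QCD.Cruxes.ExtinctionBuildsQCD.BlockAwayTheSign

open scoped BigOperators Classical Matrix
open Matrix
open Literature.MathematicalPhysics.QuantumLattice Literature.MathematicalPhysics.QuantumFieldTheory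
open Literature.Probability.LatticeModels (TorusSite)

namespace IndexAPSubPer

/-! ## The uniform scalar twist of a `U(3)` lattice gauge field -/

section Twist

variable {L : ℕ}

/-- `c • 1 ∈ U(3)` for a unit complex number `c`. -/
theorem smul_one_mem_unitaryGroup {c : ℂ} (hc : ‖c‖ = 1) :
    c • (1 : Matrix (Fin 3) (Fin 3) ℂ) ∈ Matrix.unitaryGroup (Fin 3) ℂ := by
  rw [Matrix.mem_unitaryGroup_iff, star_smul, star_one, Matrix.smul_mul, Matrix.one_mul, smul_smul,
    Complex.star_def, Complex.mul_conj, Complex.normSq_eq_norm_sq, hc]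
  simp

/-- The forward link hop of the twisted field `u · V`, `u = c • 1`, is `c` times that of `V`. -/
theorem linkHop_twist (u : Matrix.unitaryGroup (Fin 3) ℂ) (c : ℂ)
    (hu : (u : Matrix (Fin 3) (Fin 3) ℂ) = c • 1) (V : GaugeConfig 4 L (Matrix.unitaryGroup (Fin 3) ℂ))
    (μ : Fin 4) :
    linkHop (unitaryFundamentalRep (Fin 3) ℂ) (fun e => u * V e) μ =
      c • linkHop (unitaryFundamentalRep (Fin 3) ℂ) V μ := by
  ext p q
  simp only [linkHop, Matrix.of_apply, Matrix.smul_apply, smul_eq_mul, unitaryFundamentalRep_apply,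
    Submonoid.coe_mul, hu, Matrix.smul_mul, Matrix.one_mul, mul_ite, mul_zero]

/-- Splitting `c x + c̄ y` into real and imaginary parts of `c`. -/
theorem scalar_split (c x y : ℂ) :
    c * x + star c * y =
      (c.re : ℂ) * x + (c.re : ℂ) * y + ((c.im : ℂ) * Complex.I * x + (c.im : ℂ) * star Complex.I * y) := by
  apply Complex.ext <;> simp <;> ring

/-- **The hopping matrix of the twisted field**: `W_μ(c·V) = Re c · W_μ(V) + Im c · W_μ(i·V)` (the forward
hop picks up `c`, the backward hop `c̄`); `uI` is the central element `i • 1`. -/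
theorem wilsonHop_twist (u : Matrix.unitaryGroup (Fin 3) ℂ) (c : ℂ)
    (hu : (u : Matrix (Fin 3) (Fin 3) ℂ) = c • 1) (uI : Matrix.unitaryGroup (Fin 3) ℂ)
    (huI : (uI : Matrix (Fin 3) (Fin 3) ℂ) = Complex.I • 1)
    (V : GaugeConfig 4 L (Matrix.unitaryGroup (Fin 3) ℂ)) (μ : Fin 4) :
    wilsonHop (unitaryFundamentalRep (Fin 3) ℂ) (fun e => u * V e) μ =
      (c.re : ℂ) • wilsonHop (unitaryFundamentalRep (Fin 3) ℂ) V μ +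
        (c.im : ℂ) • wilsonHop (unitaryFundamentalRep (Fin 3) ℂ) (fun e => uI * V e) μ := by
  simp only [wilsonHop, linkHop_twist u c hu, linkHop_twist uI Complex.I huI, Matrix.conjTranspose_smul,
    Matrix.smul_kronecker, Matrix.reindex_apply]
  ext i j
  simp only [Matrix.submatrix_apply, Matrix.add_apply, Matrix.smul_apply, smul_eq_mul]
  rw [scalar_split c]
  ring

open scoped Matrix.Norms.L2Operator

/-- `‖W_μ(c·V) − W_μ(V)‖ ≤ 2|c − 1|` in the `ℓ²` operator norm (each hopping matrix is an isometry,
`l2_opNorm_wilsonHop_le`). -/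
theorem norm_wilsonHop_twist_sub_le [NeZero L] (u : Matrix.unitaryGroup (Fin 3) ℂ) (c : ℂ)
    (hu : (u : Matrix (Fin 3) (Fin 3) ℂ) = c • 1) (V : GaugeConfig 4 L (Matrix.unitaryGroup (Fin 3) ℂ))
    (μ : Fin 4) :
    ‖wilsonHop (unitaryFundamentalRep (Fin 3) ℂ) (fun e => u * V e) μ -
        wilsonHop (unitaryFundamentalRep (Fin 3) ℂ) V μ‖ ≤ 2 * ‖c - 1‖ := by
  have hρ : ∀ g, unitaryFundamentalRep (Fin 3) ℂ g ∈ Matrix.unitaryGroup (Fin 3) ℂ :=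
    unitaryFundamentalRep_mem_unitaryGroup
  let uI : Matrix.unitaryGroup (Fin 3) ℂ :=
    ⟨Complex.I • 1, smul_one_mem_unitaryGroup Complex.norm_I⟩
  set W := wilsonHop (unitaryFundamentalRep (Fin 3) ℂ) V μ with hW
  set W' := wilsonHop (unitaryFundamentalRep (Fin 3) ℂ) (fun e => uI * V e) μ with hW'
  rw [wilsonHop_twist u c hu uI rfl]
  have hsplit : (c.re : ℂ) • W + (c.im : ℂ) • W' - W = ((c.re - 1 : ℝ) : ℂ) • W + (c.im : ℂ) • W' := by
    rw [Complex.ofReal_sub, Complex.ofReal_one, sub_smul, one_smul]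
    abel
  rw [hsplit]
  have h1 : |c.re - 1| ≤ ‖c - 1‖ := by simpa using Complex.abs_re_le_norm (c - 1)
  have h2 : |c.im| ≤ ‖c - 1‖ := by simpa using Complex.abs_im_le_norm (c - 1)
  calc ‖((c.re - 1 : ℝ) : ℂ) • W + (c.im : ℂ) • W'‖
      ≤ ‖((c.re - 1 : ℝ) : ℂ) • W‖ + ‖(c.im : ℂ) • W'‖ := norm_add_le _ _
    _ = |c.re - 1| * ‖W‖ + |c.im| * ‖W'‖ := by
        rw [norm_smul, norm_smul, Complex.norm_real, Complex.norm_real, Real.norm_eq_abs,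
          Real.norm_eq_abs]
    _ ≤ |c.re - 1| * 1 + |c.im| * 1 := by
        gcongr
        · exact l2_opNorm_wilsonHop_le _ hρ _ _
        · exact l2_opNorm_wilsonHop_le _ hρ _ _
    _ ≤ ‖c - 1‖ + ‖c - 1‖ := by linarith
    _ = 2 * ‖c - 1‖ := by ring

/-- `D_W(c·V) − D_W(V) = −Σ_μ (W_μ(c·V) − W_μ(V))` (the mass terms cancel). -/
theorem wilsonDirac_twist_sub (u : Matrix.unitaryGroup (Fin 3) ℂ)
    (V : GaugeConfig 4 L (Matrix.unitaryGroup (Fin 3) ℂ)) (m : ℝ) :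
    wilsonDirac (unitaryFundamentalRep (Fin 3) ℂ) (fun e => u * V e) m 1 -
        wilsonDirac (unitaryFundamentalRep (Fin 3) ℂ) V m 1 =
      -∑ μ, (wilsonHop (unitaryFundamentalRep (Fin 3) ℂ) (fun e => u * V e) μ -
        wilsonHop (unitaryFundamentalRep (Fin 3) ℂ) V μ) := by
  have hρ : ∀ g, unitaryFundamentalRep (Fin 3) ℂ g ∈ Matrix.unitaryGroup (Fin 3) ℂ :=
    unitaryFundamentalRep_mem_unitaryGroup
  rw [wilsonDirac_eq_sub_sum_wilsonHop _ hρ, wilsonDirac_eq_sub_sum_wilsonHop _ hρ,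
    Finset.sum_sub_distrib]
  abel

/-- `‖D_W(c·V) − D_W(V)‖ ≤ 8|c − 1|`. -/
theorem norm_wilsonDirac_twist_sub_le [NeZero L] (u : Matrix.unitaryGroup (Fin 3) ℂ) (c : ℂ)
    (hu : (u : Matrix (Fin 3) (Fin 3) ℂ) = c • 1) (V : GaugeConfig 4 L (Matrix.unitaryGroup (Fin 3) ℂ))
    (m : ℝ) :
    ‖wilsonDirac (unitaryFundamentalRep (Fin 3) ℂ) (fun e => u * V e) m 1 -
        wilsonDirac (unitaryFundamentalRep (Fin 3) ℂ) V m 1‖ ≤ 8 * ‖c - 1‖ := by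
  rw [wilsonDirac_twist_sub, norm_neg]
  calc ‖∑ μ, (wilsonHop (unitaryFundamentalRep (Fin 3) ℂ) (fun e => u * V e) μ -
          wilsonHop (unitaryFundamentalRep (Fin 3) ℂ) V μ)‖
      ≤ ∑ μ, ‖wilsonHop (unitaryFundamentalRep (Fin 3) ℂ) (fun e => u * V e) μ -
          wilsonHop (unitaryFundamentalRep (Fin 3) ℂ) V μ‖ := norm_sum_le _ _
    _ ≤ ∑ _μ : Fin 4, 2 * ‖c - 1‖ :=
        Finset.sum_le_sum fun μ _ => norm_wilsonHop_twist_sub_le u c hu V μ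
    _ = 8 * ‖c - 1‖ := by simp; ring

/-- `‖Γ₅‖ ≤ 1` (`Γ₅ = 1 ⊗ 1 ⊗ γ₅` is a Hermitian involution). -/
theorem norm_spinorLift_gammaFive_le [NeZero L] :
    ‖(spinorLift gammaFive :
        Matrix (TorusSite 4 L × Fin 3 × Fin 4) (TorusSite 4 L × Fin 3 × Fin 4) ℂ)‖ ≤ 1 := by
  have hone : ‖(1 : Matrix (TorusSite 4 L × Fin 3 × Fin 4) (TorusSite 4 L × Fin 3 × Fin 4) ℂ)‖
      ≤ 1 := by
    rw [Matrix.cstar_norm_def, map_one]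
    exact ContinuousLinearMap.norm_id_le
  have hsq : ‖(spinorLift gammaFive :
        Matrix (TorusSite 4 L × Fin 3 × Fin 4) (TorusSite 4 L × Fin 3 × Fin 4) ℂ)‖ *
      ‖(spinorLift gammaFive :
        Matrix (TorusSite 4 L × Fin 3 × Fin 4) (TorusSite 4 L × Fin 3 × Fin 4) ℂ)‖ ≤ 1 := by
    rw [← CStarRing.norm_star_mul_self, star_eq_conjTranspose,
      Literature.Barriers.QuantumFields.WilsonDeterminant.conjTranspose_spinorLift_gammaFive,
      spinorLift_gammaFive_mul_self]
    exact hone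
  nlinarith [norm_nonneg (spinorLift gammaFive :
        Matrix (TorusSite 4 L × Fin 3 × Fin 4) (TorusSite 4 L × Fin 3 × Fin 4) ℂ)]

/-- **The Hermitian Wilson–Dirac operators of `c·V` and `V` differ by at most `8|c − 1|`** in the
`ℓ²` operator norm. -/
theorem norm_hermitianWilsonDirac_twist_sub_le [NeZero L] (u : Matrix.unitaryGroup (Fin 3) ℂ) (c : ℂ)
    (hu : (u : Matrix (Fin 3) (Fin 3) ℂ) = c • 1) (V : GaugeConfig 4 L (Matrix.unitaryGroup (Fin 3) ℂ))
    (m : ℝ) :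
    ‖spinorLift gammaFive * wilsonDirac (unitaryFundamentalRep (Fin 3) ℂ) (fun e => u * V e) m 1 -
        spinorLift gammaFive * wilsonDirac (unitaryFundamentalRep (Fin 3) ℂ) V m 1‖ ≤
      8 * ‖c - 1‖ := by
  rw [← Matrix.mul_sub]
  calc _ ≤ ‖(spinorLift gammaFive :
          Matrix (TorusSite 4 L × Fin 3 × Fin 4) (TorusSite 4 L × Fin 3 × Fin 4) ℂ)‖ *
        ‖wilsonDirac (unitaryFundamentalRep (Fin 3) ℂ) (fun e => u * V e) m 1 -
          wilsonDirac (unitaryFundamentalRep (Fin 3) ℂ) V m 1‖ := norm_mul_le _ _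
    _ ≤ 1 * (8 * ‖c - 1‖) :=
        mul_le_mul norm_spinorLift_gammaFive_le (norm_wilsonDirac_twist_sub_le u c hu V m)
          (norm_nonneg _) zero_le_one
    _ = 8 * ‖c - 1‖ := one_mul _

end Twist

end IndexAPSubPer

/-- **Registered sub-goal `stub_indexAPSubPerLeWindowAux2` (the uniform central twist of the hopping matrices).**
`c • 1 ∈ U(3)` for `|c| = 1`, and for `u = c • 1`, `uI = i • 1`: `W_μ(u·V) = Re c · W_μ(V) + Im c · W_μ(uI·V)`.
[MontvayMunster1994 §4.2.4 (4.112)–(4.115)] -/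
theorem stub_indexAPSubPerLeWindowAux2 : (∀ {c : ℂ}, ‖c‖ = 1 → c • (1 : Matrix (Fin 3) (Fin 3) ℂ) ∈ Matrix.unitaryGroup (Fin 3) ℂ) ∧ (∀ {L : ℕ} (u : Matrix.unitaryGroup (Fin 3) ℂ) (c : ℂ), (u : Matrix (Fin 3) (Fin 3) ℂ) = c • 1 → ∀ (uI : Matrix.unitaryGroup (Fin 3) ℂ), (uI : Matrix (Fin 3) (Fin 3) ℂ) = Complex.I • 1 → ∀ (V : GaugeConfig 4 L (Matrix.unitaryGroup (Fin 3) ℂ)) (μ : Fin 4), Literature.MathematicalPhysics.QuantumLattice.wilsonHop (unitaryFundamentalRep (Fin 3) ℂ) (fun e => u * V e) μ = (c.re : ℂ) • Literature.MathematicalPhysics.QuantumLattice.wilsonHop (unitaryFundamentalRep (Fin 3) ℂ) V μ + (c.im : ℂ) • Literature.MathematicalPhysics.QuantumLattice.wilsonHop (unitaryFundamentalRep (Fin 3) ℂ) (fun e => uI * V e) μ) :=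
  ⟨fun hc => IndexAPSubPer.smul_one_mem_unitaryGroup hc,
    fun u c hu uI huI V μ => IndexAPSubPer.wilsonHop_twist u c hu uI huI V μ⟩

end Summit.QuantumFields.QCD.Cruxes.ExtinctionBuildsQCD.BlockAwayTheSign

end
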